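import Literature.NumberTheory.Transcendental.MultipleZetaDepthTwoProofs
import HarnessLib

/-!
# Multiple zeta values — proofs: Hoffman's relation (Hoffman 1992, Theorem 5.1) in general

Sibling proof file of `Literature.NumberTheory.Transcendental.MultipleZeta` and of the named fact
`hoffman_relation` (`MultipleZetaHoffmanRelation.lean`, which imports this file to discharge it).
It proves, sorry-free and with no named fact, **Hoffman's relation** for the multiple zeta values
`ζ(s₁,…,s_k) = ∑_{n₁ > ⋯ > n_k ≥ 1} ∏ nᵢ^{-sᵢ}` (`multipleZeta`, decreasing convention = Hoffman's
`A(i₁,…,i_k)`): for every admissible index `s`,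

  `∑_l ζ(s₁,…,s_l + 1,…,s_k) = ∑_l ∑_{j=0}^{s_l − 2} ζ(s₁,…,s_{l−1}, s_l − j, j + 1, s_{l+1},…,s_k)`

(`multipleZeta_hoffman_relation`, stated in the position/`List.take`/`List.drop` indexing of the
named fact). M. E. Hoffman, *Multiple harmonic series*, Pacific J. Math. **152** (1992) 275–290,
Theorem 5.1 (p. 286), proof pp. 286–288.

## The printed proof and this file

We follow Hoffman's proof (pp. 286–288) step by step; all series manipulations are done in `ℝ≥0∞`
(series of nonnegative terms: `ENNReal.tsum_comm`, `ENNReal.tsum_add`, … need no summability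
bookkeeping, as in the sibling files), and only the final cancellation uses finiteness.

* Hoffman's (1), "by multiplying series":
  `∑_l A(i + e_l) + ∑_{l=1}^{k} A(i₁,…,i_l,1,i_{l+1},…,i_k) = ∑_{m₁>⋯>m_k} m^{-i} H_{m₁}` (`=: T`),
  `H_m = ∑_{n ≤ m} 1/n`, by distributing `n` over the positions of the chain — this is the
  (truncated, exact) harmonic product with the index `(1)`: `MZV.HoffmanRel.ascK_harm_mul`.
* Hoffman's (2): `H_m/m = ∑_{n ≥ 1} 1/(n(n+m))` (telescoping), so that `T` is a sum over chains
  with one extra element `X = m₁ + n` on top carrying the weight `X^{-1}(X − m₁)^{-1}`: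
  `MZV.HoffmanRel.ascK_pw_succ_harm` (from `tsum_ofReal_inv_mul_succ_eq` of the depth-two file).
* "a standard partial-fractions identity":
  `1/(N^b d X^c) = ∑_{j<b} 1/(N^{j+1} X^{b+c−j}) + 1/(X^{b+c} d)` for `X = N + d`
  (`MZV.HoffmanRel.one_div_pow_mul_pow_mul`, `…ascK_pw_hw`), and "the sum is unchanged by
  permuting `n_k` and `n_{k+1}`" (the swap of two consecutive gaps, `MZV.HoffmanRel.ascK_swap`);
  "Continuing in this way" down the chain is the induction `MZV.HoffmanRel.ascK_hole_eq_pfSum`,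
  whose output `pfSum` is Hoffman's display
  `∑_{j ≤ i₁−2} A(i₁−j, j+1, i₂,…) + ∑_{l ≥ 2} ∑_{j ≤ i_l − 1} A(…, i_l − j, j+1, …) + A(i,1)`
  (`MZV.HoffmanRel.pfSum_zero_eq` separates the `j = i_l − 1` terms, which are the inserted-`1`
  indices).
* "the conclusion follows by substitution for (2) on the right-hand side of (1) and appropriate
  cancellation": the inserted-`1` terms form a finite quantity (each is an admissible MZV), which is
  cancelled in `ℝ≥0∞`; the identity returns to `ℝ` through `ENNReal.ofReal_eq_ofReal_iff`.

The one piece of infrastructure is the bottom-up nested sum `MZV.HoffmanRel.ascK ws K B` over chains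
`B < m₁ < m₂ < ⋯` with two-argument weights (element below, gap), in which Hoffman's sum coordinates
`s_r = n₁ + ⋯ + n_r` are the recursion itself, a "hole" `X^{-c}(X − N)^{-1}` is just another weight
(`MZV.HoffmanRel.hw`), and the bottom convention `N_{k+1} = 0` is automatic; the link with
`multipleZeta` is `MZV.HoffmanRel.ofReal_multipleZeta_eq_A` (via `ofReal_multipleZeta_eq_tsum`,
peeling the smallest element of a chain with `Fin.snoc`). Combinatorial gadgets: `plusOne`, `insOne`
(raise one entry / insert a `1`), `pfSum`, `splSum`, `insSum` (the produced indices,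
prefix-accumulated), and `fin_sum_plusOne` / `fin_sum_splSum` matching the `Fin`-indexed sums of the
named fact. No named facts and no statement of the tree is changed.

Not here: Hoffman's Theorems 2.1, 2.2 (symmetric sums), 4.4 (the duality family, cf.
`MultipleZetaDuality.lean`), the derivation / regularised double shuffle reformulations
(Hoffman–Ohno 2003, Ihara–Kaneko–Zagier 2006), Ohno's generalisation.

## References

* M. E. Hoffman, *Multiple harmonic series*, Pacific J. Math. **152** (1992), 275–290
  (doi:10.2140/pjm.1992.152.275): Theorem 5.1, p. 286; proof pp. 286–288. [Hoffman1992]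
* J. M. Borwein, D. M. Bradley, *Thirty-two Goldbach variations*, Int. J. Number Theory 2 (2006),
  65–103, §2 (the telescoping series `∑ 1/(n(n+m)) = H_m/m`). [BorweinBradley2006]
-/

noncomputable section

open scoped BigOperators ENNReal
open Filter _root_.Topology

namespace Literature.NumberTheory.Transcendental

/-- An index `(a, t…)` is admissible iff `a ≥ 2` and all entries of `t` are positive. [folklore] -/
theorem MZV.isAdmissible_cons_iff {a : ℕ} {t : List ℕ} :
    MZV.IsAdmissible (a :: t) ↔ 2 ≤ a ∧ ∀ i ∈ t, 1 ≤ i := by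
  constructor
  · rintro ⟨h1, h2⟩
    exact ⟨by simpa using h2 (List.cons_ne_nil a t), fun i hi => h1 i (List.mem_cons_of_mem a hi)⟩
  · rintro ⟨ha, ht⟩
    refine ⟨fun i hi => ?_, fun _ => by simpa using ha⟩
    rcases List.mem_cons.mp hi with rfl | hi
    · omega
    · exact ht i hi

/-- `ζ(s) ≥ 0` for every index (a series of nonnegative terms, junk value `0` included).
[folklore] -/
theorem multipleZeta_nonneg (s : List ℕ) : 0 ≤ multipleZeta s :=
  tsum_nonneg fun n => mzvTerm_nonneg s n.1

namespace MZV.HoffmanRel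


/-- Power weight: the chain element `B + d + 1` above `B` weighs `(B+d+1)^{-a}`. [folklore] -/
def pw (a : ℕ) : ℕ → ℕ → ℝ≥0∞ := fun B d => ENNReal.ofReal (1 / ((B : ℝ) + d + 1) ^ a)

/-- Hole weight: the chain element `B + d + 1` above `B` weighs `(B+d+1)^{-c} (d+1)^{-1}`
(power times the inverse gap to the element below). [folklore] -/
def hw (c : ℕ) : ℕ → ℕ → ℝ≥0∞ :=
  fun B d => ENNReal.ofReal (1 / (((B : ℝ) + d + 1) ^ c * ((d : ℝ) + 1)))

/-- Bottom-up nested sums over chains `B < m₁ < m₂ < ⋯ < m_r` with weights `ws` (listed from the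
bottom) and a continuation `K` evaluated at the top element. [folklore] -/
def ascK : List (ℕ → ℕ → ℝ≥0∞) → (ℕ → ℝ≥0∞) → ℕ → ℝ≥0∞
  | [], K, B => K B
  | w :: ws, K, B => ∑' d : ℕ, w B d * ascK ws K (B + d + 1)

/-- The empty chain: only the continuation. [folklore] -/
@[simp] theorem ascK_nil (K : ℕ → ℝ≥0∞) (B : ℕ) : ascK [] K B = K B := rfl

/-- Unfolding one level of the nested sum. [folklore] -/
theorem ascK_cons (w : ℕ → ℕ → ℝ≥0∞) (ws : List (ℕ → ℕ → ℝ≥0∞)) (K : ℕ → ℝ≥0∞) (B : ℕ) :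
    ascK (w :: ws) K B = ∑' d : ℕ, w B d * ascK ws K (B + d + 1) := rfl

/-- Stacking chains: the weights `L ++ M` amount to the chain `L` continued by the chain `M`.
[folklore] -/
theorem ascK_append (L M : List (ℕ → ℕ → ℝ≥0∞)) (K : ℕ → ℝ≥0∞) :
    ∀ B, ascK (L ++ M) K B = ascK L (ascK M K) B := by
  induction L with
  | nil => intro B; rfl
  | cons w L ih => intro B; simp only [List.cons_append, ascK_cons, ih]

/-- `ascK_append` as an equality of continuations. [folklore] -/
theorem ascK_append' (L M : List (ℕ → ℕ → ℝ≥0∞)) (K : ℕ → ℝ≥0∞) :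
    ascK (L ++ M) K = ascK L (ascK M K) := funext (ascK_append L M K)

/-- The nested sum is additive in the continuation. [folklore] -/
theorem ascK_add (L : List (ℕ → ℕ → ℝ≥0∞)) (K K' : ℕ → ℝ≥0∞) :
    ∀ B, ascK L (fun t => K t + K' t) B = ascK L K B + ascK L K' B := by
  induction L with
  | nil => intro B; rfl
  | cons w L ih =>
    intro B
    simp only [ascK_cons, ih, mul_add]
    exact ENNReal.tsum_add

/-- The nested sum commutes with finite sums of continuations. [folklore] -/
theorem ascK_finset_sum {ι : Type*} (s : Finset ι) (L : List (ℕ → ℕ → ℝ≥0∞))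
    (K : ι → ℕ → ℝ≥0∞) (B : ℕ) :
    ascK L (fun t => ∑ j ∈ s, K j t) B = ∑ j ∈ s, ascK L (K j) B := by
  classical
  induction s using Finset.induction_on with
  | empty =>
    simp only [Finset.sum_empty]
    induction L generalizing B with
    | nil => rfl
    | cons w L ih => simp [ascK_cons, ih]
  | insert j s hj ih =>
    simp only [Finset.sum_insert hj, ← ih]
    exact ascK_add L _ _ B

/-- The nested sum of the power weights of an index `u` (decreasing convention), i.e.
`∑_{m₁ > ⋯ > m_k ≥ 1} ∏ m_r^{-u_r}` as an element of `ℝ≥0∞`. [folklore] -/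
def A (u : List ℕ) : ℝ≥0∞ := ascK (u.reverse.map pw) (fun _ => 1) 0

/-! ### Link with `multipleZeta` -/

/-- A tuple `(n', m)` is a strictly decreasing chain above `B` iff `B < m`, and `n'` is a
strictly decreasing chain above `m`. [folklore] -/
theorem strictAnti_snoc_iff {k : ℕ} (n : Fin k → ℕ) (m B : ℕ) :
    (StrictAnti (Fin.snoc n m : Fin (k + 1) → ℕ) ∧ ∀ i, B < (Fin.snoc n m : Fin (k + 1) → ℕ) i) ↔
      B < m ∧ (StrictAnti n ∧ ∀ i, m < n i) := by
  constructor
  · rintro ⟨hanti, hB⟩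
    refine ⟨by simpa using hB (Fin.last k), fun i j hij => ?_, fun i => ?_⟩
    · have := hanti (Fin.castSucc_lt_castSucc_iff.mpr hij)
      simpa using this
    · have := hanti (Fin.castSucc_lt_last i)
      simpa using this
  · rintro ⟨hB, hanti, hm⟩
    refine ⟨fun i j hij => ?_, fun i => ?_⟩
    · cases j using Fin.lastCases with
      | last =>
        cases i using Fin.lastCases with
        | last => exact absurd hij (lt_irrefl _)
        | cast i => simpa using hm i
      | cast j =>
        cases i using Fin.lastCases with
        | last => exact absurd hij (not_lt.mpr (Fin.castSucc_lt_last j).le)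
        | cast i => simpa using hanti (Fin.castSucc_lt_castSucc_iff.mp hij)
    · cases i using Fin.lastCases with
      | last => simpa using hB
      | cast i => simpa using hB.trans (hm i)

/-- `(n', m) ↦ snoc n' m`. [folklore] -/
def snocEquiv (k : ℕ) : (Fin k → ℕ) × ℕ ≃ (Fin (k + 1) → ℕ) where
  toFun p := Fin.snoc p.1 p.2
  invFun n := (Fin.init n, n (Fin.last k))
  left_inv p := by simp
  right_inv n := by simp [Fin.snoc_init_self]

/-- Reindexing `∑_{m > B} g(m) = ∑_{d ≥ 0} g(B + d + 1)` in `ℝ≥0∞`. [folklore] -/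
theorem tsum_ite_lt_eq (B : ℕ) (g : ℕ → ℝ≥0∞) :
    (∑' m : ℕ, if B < m then g m else 0) = ∑' d : ℕ, g (B + d + 1) := by
  classical
  rw [← (ENNReal.summable).sum_add_tsum_nat_add' (f := fun m => if B < m then g m else 0)
    (k := B + 1), Finset.sum_eq_zero (fun i hi => if_neg (by
      have := Finset.mem_range.mp hi; omega)), zero_add]
  exact tsum_congr fun d => by rw [if_pos (by omega)]; congr 1; omega

/-- The series of `∏ᵢ nᵢ^{-σᵢ}` over strictly decreasing chains `n` above `B`, as a bottom-up
nested sum: peel off the smallest element `n_k = B + d + 1` (`Fin.snoc`) and recurse. [folklore] -/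
theorem tsum_chain_eq_ascK : ∀ (k : ℕ) (σ : Fin k → ℕ) (B : ℕ),
    (∑' n : Fin k → ℕ, Set.indicator {n : Fin k → ℕ | StrictAnti n ∧ ∀ i, B < n i}
        (fun n => ENNReal.ofReal (∏ i, 1 / ((n i : ℝ)) ^ (σ i))) n) =
      ascK ((List.ofFn σ).reverse.map pw) (fun _ => 1) B := by
  classical
  intro k
  induction k with
  | zero =>
    intro σ B
    have h1 : ∀ n : Fin 0 → ℕ, n ∈ {n : Fin 0 → ℕ | StrictAnti n ∧ ∀ i, B < n i} := fun n =>
      ⟨fun i => i.elim0, fun i => i.elim0⟩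
    simp only [Set.indicator_of_mem (h1 _), Finset.univ_eq_empty, Finset.prod_empty,
      ENNReal.ofReal_one, List.ofFn_zero, List.reverse_nil, List.map_nil, ascK_nil]
    rw [tsum_eq_single (fun i => i.elim0 : Fin 0 → ℕ)
      (fun n hn => absurd (funext fun i => i.elim0) hn)]
  | succ k ih =>
    intro σ B
    rw [← (snocEquiv k).tsum_eq, ENNReal.tsum_prod', ENNReal.tsum_comm]
    rw [List.ofFn_succ', List.concat_eq_append, List.reverse_append, List.reverse_singleton,
      List.singleton_append, List.map_cons, ascK_cons]
    have hterm : ∀ (m : ℕ) (n : Fin k → ℕ),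
        Set.indicator {n : Fin (k + 1) → ℕ | StrictAnti n ∧ ∀ i, B < n i}
            (fun n => ENNReal.ofReal (∏ i, 1 / ((n i : ℝ)) ^ (σ i))) (snocEquiv k (n, m)) =
          (if B < m then ENNReal.ofReal (1 / (m : ℝ) ^ (σ (Fin.last k))) else 0) *
            Set.indicator {n : Fin k → ℕ | StrictAnti n ∧ ∀ i, m < n i}
              (fun n => ENNReal.ofReal (∏ i, 1 / ((n i : ℝ)) ^ (σ (Fin.castSucc i)))) n := by
      intro m n
      simp only [snocEquiv, Equiv.coe_fn_mk, Set.indicator_apply, Set.mem_setOf_eq]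
      by_cases hB : B < m
      · by_cases hn : StrictAnti n ∧ ∀ i, m < n i
        · rw [if_pos ((strictAnti_snoc_iff n m B).mpr ⟨hB, hn⟩), if_pos hB, if_pos hn,
            Fin.prod_univ_castSucc]
          simp only [Fin.snoc_castSucc, Fin.snoc_last]
          rw [mul_comm, ENNReal.ofReal_mul (by positivity)]
        · rw [if_neg (fun h => hn ((strictAnti_snoc_iff n m B).mp h).2), if_neg hn, mul_zero]
      · rw [if_neg (fun h => hB ((strictAnti_snoc_iff n m B).mp h).1), if_neg hB, zero_mul]
    simp only [hterm]
    simp_rw [ENNReal.tsum_mul_left, ih, ite_mul, zero_mul]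
    rw [tsum_ite_lt_eq]
    refine tsum_congr fun d => ?_
    simp only [pw]
    congr 2
    push_cast
    ring

/-- **Link lemma**: for an admissible index, `ENNReal.ofReal (ζ(s))` is the bottom-up nested sum
`A s` of its power weights. [folklore] -/
theorem ofReal_multipleZeta_eq_A {s : List ℕ} (hs : MZV.IsAdmissible s) :
    ENNReal.ofReal (multipleZeta s) = A s := by
  rw [ofReal_multipleZeta_eq_tsum hs (Equiv.refl _)]
  simp only [Equiv.refl_apply]
  rw [tsum_subtype (mzvIndexSet s.length) (fun n => ENNReal.ofReal (mzvTerm s n))]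
  have h := tsum_chain_eq_ascK s.length s.get 0
  rw [List.ofFn_get] at h
  unfold A
  rw [← h]
  refine tsum_congr fun n => ?_
  simp only [mzvIndexSet, mzvTerm, one_div, List.get_eq_getElem, Fin.getElem_fin]

/-! ### The harmonic factor: stuffle with `(1)` (Hoffman's (1)) -/

/-- `H_N = ∑_{i<N} 1/(i+1)` in `ℝ≥0∞`. [folklore] -/
def harm (N : ℕ) : ℝ≥0∞ := ∑ i ∈ Finset.range N, ENNReal.ofReal (1 / ((i : ℝ) + 1))

/-- `H_0 = 0`. [folklore] -/
@[simp] theorem harm_zero : harm 0 = 0 := by simp [harm]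

/-- `H_{N+d+1} = H_N + ∑_{i<d} 1/(N+i+1) + 1/(N+d+1)`. [folklore] -/
theorem harm_add (N d : ℕ) : harm (N + d + 1) =
    harm N + ∑ i ∈ Finset.range d, ENNReal.ofReal (1 / ((N : ℝ) + i + 1)) +
      ENNReal.ofReal (1 / ((N : ℝ) + d + 1)) := by
  unfold harm
  rw [add_assoc, Finset.sum_range_add, Finset.sum_range_succ]
  push_cast
  simp only [add_assoc]

/-- All insertions of an extra `+1` into one entry: `plusOne (s₁,…,s_k)` lists the indices
`(s₁,…,s_l + 1,…,s_k)`, `l = 1,…,k`. [folklore] -/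
def plusOne : List ℕ → List (List ℕ)
  | [] => []
  | b :: u => ((b + 1) :: u) :: (plusOne u).map (List.cons b)

/-- All insertions of an entry `1` NOT at the front: `insOne (s₁,…,s_k)` lists
`(s₁,…,s_l, 1, s_{l+1},…,s_k)`, `l = 1,…,k`. [folklore] -/
def insOne : List ℕ → List (List ℕ)
  | [] => []
  | b :: u => (b :: 1 :: u) :: (insOne u).map (List.cons b)

/-- One level of the distribution of `H_M = ∑_{n ≤ M} 1/n` over the chain: for the top weight
`M^{-b}`, `∑_{M > N} M^{-b} H_M K(M) = H_N ∑_M M^{-b} K(M) + ∑_{M > n > N} n^{-1} M^{-b} K(M)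
+ ∑_M M^{-(b+1)} K(M)`. [folklore] -/
theorem ascK_pw_harm_mul (b : ℕ) (K : ℕ → ℝ≥0∞) (N : ℕ) :
    ascK [pw b] (fun t => harm t * K t) N =
      harm N * ascK [pw b] K N + ascK [pw 1, pw b] K N + ascK [pw (b + 1)] K N := by
  simp only [ascK_cons, ascK_nil]
  have hsplit : ∀ d : ℕ, pw b N d * (harm (N + d + 1) * K (N + d + 1)) =
      harm N * (pw b N d * K (N + d + 1)) +
        (∑ i ∈ Finset.range d,
          ENNReal.ofReal (1 / ((N : ℝ) + i + 1)) * (pw b N d * K (N + d + 1))) +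
        pw (b + 1) N d * K (N + d + 1) := by
    intro d
    rw [harm_add, add_mul, add_mul, mul_add, mul_add, Finset.sum_mul, Finset.mul_sum]
    have h3 : pw b N d * (ENNReal.ofReal (1 / ((N : ℝ) + d + 1)) * K (N + d + 1)) =
        pw (b + 1) N d * K (N + d + 1) := by
      rw [← mul_assoc]
      congr 1
      simp only [pw]
      rw [← ENNReal.ofReal_mul (by positivity)]
      congr 1
      rw [pow_succ]
      field_simp
    rw [h3]
    congr 1
    congr 1
    · ring
    · exact Finset.sum_congr rfl fun i _ => by ring
  simp_rw [hsplit]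
  rw [ENNReal.tsum_add, ENNReal.tsum_add, ENNReal.tsum_mul_left,
    ennreal_tsum_sum_range_eq_tsum_prod, ENNReal.tsum_prod']
  congr 2
  simp_rw [← ENNReal.tsum_mul_left]
  refine tsum_congr fun i => tsum_congr fun d => ?_
  have hK : N + (d + i + 1) + 1 = N + i + 1 + d + 1 := by omega
  rw [hK, ← mul_assoc, ← mul_assoc]
  congr 1
  simp only [pw, pow_one]
  rw [← ENNReal.ofReal_mul (by positivity), ← ENNReal.ofReal_mul (by positivity),
    div_mul_div_comm, div_mul_div_comm, one_mul]
  congr 2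
  push_cast
  ring

/-- **Hoffman's (1)** (stuffle of a chain with the harmonic factor): distributing
`H_{m₁} = ∑_{n ≤ m₁} 1/n` over the positions of `n` relative to the chain `m₁ > ⋯ > m_k > B`
gives `H_B` times the chain, plus the chains with one exponent raised by one, plus the chains
with an entry `1` inserted anywhere except at the front. [cite: Hoffman1992, Theorem 5.1 (proof, (1))] -/
theorem ascK_harm_mul : ∀ (u : List ℕ) (K : ℕ → ℝ≥0∞) (B : ℕ),
    ascK (u.reverse.map pw) (fun t => harm t * K t) B =
      harm B * ascK (u.reverse.map pw) K B +
        ((plusOne u).map fun v => ascK (v.reverse.map pw) K B).sum +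
        ((insOne u).map fun v => ascK (v.reverse.map pw) K B).sum := by
  intro u
  induction u with
  | nil => intro K B; simp [plusOne, insOne]
  | cons b u ih =>
    intro K B
    have hrev : ∀ v : List ℕ, ((b :: v).reverse.map pw) = v.reverse.map pw ++ [pw b] := fun v => by
      simp
    have hLI : (ascK [pw b] fun t => harm t * K t) = fun N =>
        (harm N * ascK [pw b] K N + ascK [pw 1, pw b] K N) + ascK [pw (b + 1)] K N :=
      funext fun N => ascK_pw_harm_mul b K N
    conv_lhs => rw [hrev, ascK_append, hLI, ascK_add, ascK_add, ih (ascK [pw b] K) B]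
    have e1 : ∀ v : List ℕ, ascK (v.reverse.map pw) (ascK [pw b] K) B =
        ascK ((b :: v).reverse.map pw) K B := fun v => by rw [hrev, ascK_append]
    have e2 : ascK (u.reverse.map pw) (ascK [pw 1, pw b] K) B =
        ascK ((b :: 1 :: u).reverse.map pw) K B := by
      rw [← ascK_append]; congr 1; simp
    have e3 : ascK (u.reverse.map pw) (ascK [pw (b + 1)] K) B =
        ascK (((b + 1) :: u).reverse.map pw) K B := by
      rw [← ascK_append]; congr 1; simp
    simp only [e1, e2, e3, plusOne, insOne, List.map_cons, List.map_map, List.sum_cons,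
      Function.comp_def]
    ring

/-! ### Telescoping: `H_M / M = ∑_{n ≥ 1} 1/(n(n+M))` (Hoffman's (2)) -/

/-- `∑_{d ≥ 0} 1/((m+d+2)(d+1)) = H_{m+1}/(m+1)`. [folklore] -/
theorem tsum_inv_mul_gap (m : ℕ) :
    ∑' d : ℕ, ENNReal.ofReal (1 / (((m : ℝ) + 1 + d + 1) * ((d : ℝ) + 1))) =
      ENNReal.ofReal (1 / ((m : ℝ) + 1)) * harm (m + 1) := by
  have hdec : ∀ d : ℕ, ENNReal.ofReal (1 / (((m : ℝ) + 1 + d + 1) * ((d : ℝ) + 1))) =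
      ∑ j ∈ Finset.range (m + 1), ENNReal.ofReal (1 / ((m : ℝ) + 1)) *
        ENNReal.ofReal (1 / (((d : ℝ) + j + 1) * ((d : ℝ) + j + 2))) := by
    intro d
    simp_rw [← ENNReal.ofReal_mul (show (0 : ℝ) ≤ 1 / ((m : ℝ) + 1) by positivity)]
    rw [← ENNReal.ofReal_sum_of_nonneg (fun j _ => by positivity), ← Finset.mul_sum,
      sum_range_inv_mul_succ_eq']
    congr 1
    push_cast
    field_simp
    ring
  simp_rw [hdec]
  rw [Summable.tsum_finsetSum (fun _ _ => ENNReal.summable)]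
  simp_rw [ENNReal.tsum_mul_left, tsum_ofReal_inv_mul_succ_eq]
  rw [harm, Finset.mul_sum]

/-- **Hoffman's (2)**: `∑_{M > N} M^{-(a+1)} H_M = ∑_{M > N} M^{-a} ∑_{X > M} X^{-1} (X-M)^{-1}`,
i.e. the top power weight with the harmonic factor becomes a power weight one lower followed by a
hole of weight `X^{-1}(X - M)^{-1}`. [cite: Hoffman1992, Theorem 5.1 (proof, (2))] -/
theorem ascK_pw_succ_harm (a N : ℕ) :
    ascK [pw (a + 1)] (fun t => harm t * 1) N = ascK [pw a, hw 1] (fun _ => 1) N := by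
  simp only [ascK_cons, ascK_nil, mul_one]
  refine tsum_congr fun d => ?_
  have h := tsum_inv_mul_gap (N + d)
  push_cast at h
  simp only [hw, pow_one, pw]
  push_cast
  rw [h, ← mul_assoc, ← ENNReal.ofReal_mul (by positivity)]
  congr 2
  rw [pow_succ, div_mul_div_comm, one_mul]

/-! ### Partial fractions (Hoffman's "standard partial-fractions identity") and the swap -/

/-- `1/(N^b (N+d)^c d) = ∑_{j<b} 1/(N^{j+1} (N+d)^{b+c-j}) + 1/((N+d)^{b+c} d)`. [folklore] -/
theorem one_div_pow_mul_pow_mul : ∀ (b c : ℕ) {N d : ℝ}, 0 < N → 0 < d →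
    1 / (N ^ b * ((N + d) ^ c * d)) =
      ∑ j ∈ Finset.range b, 1 / (N ^ (j + 1) * (N + d) ^ (b + c - j)) +
        1 / ((N + d) ^ (b + c) * d) := by
  intro b
  induction b with
  | zero => intro c N d hN hd; simp
  | succ b ih =>
    intro c N d hN hd
    have hNd : 0 < N + d := by positivity
    have step : 1 / (N ^ (b + 1) * ((N + d) ^ c * d)) =
        1 / (N ^ (b + 1) * (N + d) ^ (c + 1)) + 1 / (N ^ b * ((N + d) ^ (c + 1) * d)) := by
      field_simp
      ring
    rw [step, ih (c + 1) hN hd, Finset.sum_range_succ, show b + (c + 1) = b + 1 + c by ring,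
      show b + 1 + c - b = c + 1 by omega]
    ring

/-- The partial-fraction identity on two consecutive weights: a power weight `N^{-b}` below a
hole `X^{-c}(X-N)^{-1}` equals `∑_{j<b}` (two power weights `N^{-(j+1)}`, `X^{-(b+c-j)}`) plus
(trivial weight below a hole `X^{-(b+c)}(X-N)^{-1}`). [folklore] -/
theorem pw_mul_hw (b c B d d' : ℕ) :
    pw b B d * hw c (B + d + 1) d' =
      ∑ j ∈ Finset.range b, pw (j + 1) B d * pw (b + c - j) (B + d + 1) d' +
        pw 0 B d * hw (b + c) (B + d + 1) d' := by
  simp only [pw, hw]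
  push_cast
  rw [← ENNReal.ofReal_mul (by positivity), pow_zero, div_one, ENNReal.ofReal_one, one_mul]
  simp_rw [← ENNReal.ofReal_mul (show (0:ℝ) ≤ 1 / ((B : ℝ) + d + 1) ^ (_ + 1) by positivity)]
  rw [← ENNReal.ofReal_sum_of_nonneg (fun j _ => by positivity), ← ENNReal.ofReal_add
    (Finset.sum_nonneg fun j _ => by positivity) (by positivity)]
  congr 1
  have h := one_div_pow_mul_pow_mul b c (N := (B : ℝ) + d + 1) (d := (d' : ℝ) + 1)
    (by positivity) (by positivity)
  rw [div_mul_div_comm, one_mul, show (B : ℝ) + d + 1 + d' + 1 = (B : ℝ) + d + 1 + ((d' : ℝ) + 1)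
    by ring, h]
  congr 1
  exact Finset.sum_congr rfl fun j _ => by rw [div_mul_div_comm, one_mul]

/-- The partial fraction `pw_mul_hw` summed: a power weight below a hole expands into `b` pairs of
power weights plus a trivial weight below a hole (Hoffman's "standard partial-fractions identity"
applied inside the chain). [cite: Hoffman1992, Theorem 5.1 (proof)] -/
theorem ascK_pw_hw (b c : ℕ) (K : ℕ → ℝ≥0∞) (B : ℕ) :
    ascK [pw b, hw c] K B =
      ∑ j ∈ Finset.range b, ascK [pw (j + 1), pw (b + c - j)] K B +
        ascK [pw 0, hw (b + c)] K B := by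
  simp only [ascK_cons, ascK_nil]
  rw [← Summable.tsum_finsetSum (fun _ _ => ENNReal.summable), ← ENNReal.tsum_add]
  refine tsum_congr fun d => ?_
  simp_rw [← ENNReal.tsum_mul_left]
  rw [← Summable.tsum_finsetSum (fun _ _ => ENNReal.summable), ← ENNReal.tsum_add]
  refine tsum_congr fun d' => ?_
  simp_rw [← mul_assoc]
  rw [← Finset.sum_mul, ← add_mul, pw_mul_hw]

/-- **The swap** ("the sum is unchanged by permuting `n_k` and `n_{k+1}`"): a trivial weight
below a hole `X^{-e}(X-N)^{-1}` equals a hole `N^{0}(N-B)^{-1}` below the power weight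
`X^{-e}` — reflect `N` inside the interval `(B, X)`. [cite: Hoffman1992, Theorem 5.1 (proof)] -/
theorem ascK_swap (e : ℕ) (K : ℕ → ℝ≥0∞) (B : ℕ) :
    ascK [pw 0, hw e] K B = ascK [hw 0, pw e] K B := by
  simp only [ascK_cons, ascK_nil]
  simp_rw [← ENNReal.tsum_mul_left]
  rw [ENNReal.tsum_comm]
  refine tsum_congr fun d => tsum_congr fun d' => ?_
  have hK : B + d' + 1 + d + 1 = B + d + 1 + d' + 1 := by omega
  simp only [pw, hw, pow_zero, one_mul, div_one, ENNReal.ofReal_one, hK]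
  rw [← mul_assoc, ← ENNReal.ofReal_mul (by positivity), div_mul_div_comm, one_mul]
  congr 3
  push_cast
  ring

/-! ### Iterating down the chain ("Continuing in this way") -/

/-- The bookkeeping of the iterated partial fractions: starting from the processed prefix `p`,
a hole of extra power `c` and the unprocessed suffix `q`, `pfSum F p c q` is the sum of `F` over
all indices produced. [folklore] -/
def pfSum (F : List ℕ → ℝ≥0∞) : List ℕ → ℕ → List ℕ → ℝ≥0∞
  | p, c, [] => F (p ++ [c + 1])
  | p, c, b :: q =>
      (∑ j ∈ Finset.range b, F (p ++ (b + c - j) :: (j + 1) :: q)) + pfSum F (p ++ [b + c]) 0 q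

/-- A hole sitting directly on the bottom `0` is a plain power weight one higher. [folklore] -/
theorem ascK_hw_zero_base (c : ℕ) (L : List (ℕ → ℕ → ℝ≥0∞)) (K : ℕ → ℝ≥0∞) :
    ascK (hw c :: L) K 0 = ascK (pw (c + 1) :: L) K 0 := by
  simp only [ascK_cons]
  refine tsum_congr fun d => ?_
  congr 1
  simp only [hw, pw]
  congr 1
  push_cast
  ring

/-- **Hoffman's iteration**: the chain `(q below a hole of extra power c below p)` expands, by
the partial fraction `ascK_pw_hw` and the swap `ascK_swap` at each level, into `pfSum A p c q`.
[cite: Hoffman1992, Theorem 5.1 (proof)] -/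
theorem ascK_hole_eq_pfSum : ∀ (q p : List ℕ) (c : ℕ),
    ascK (q.reverse.map pw ++ hw c :: p.reverse.map pw) (fun _ => 1) 0 = pfSum A p c q := by
  intro q
  induction q with
  | nil =>
    intro p c
    rw [pfSum, List.reverse_nil, List.map_nil, List.nil_append, ascK_hw_zero_base, A]
    congr 1
    simp
  | cons b q ih =>
    intro p c
    have h1 : (b :: q).reverse.map pw ++ hw c :: p.reverse.map pw =
        q.reverse.map pw ++ ([pw b, hw c] ++ p.reverse.map pw) := by simp
    have hpf : ascK [pw b, hw c] (ascK (p.reverse.map pw) fun _ => 1) = fun B =>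
        ∑ j ∈ Finset.range b,
            ascK [pw (j + 1), pw (b + c - j)] (ascK (p.reverse.map pw) fun _ => 1) B +
          ascK [pw 0, hw (b + c)] (ascK (p.reverse.map pw) fun _ => 1) B :=
      funext fun B => ascK_pw_hw b c _ B
    have hsw : ascK [pw 0, hw (b + c)] (ascK (p.reverse.map pw) fun _ => 1) =
        ascK [hw 0, pw (b + c)] (ascK (p.reverse.map pw) fun _ => 1) :=
      funext fun B => ascK_swap (b + c) _ B
    rw [h1, ascK_append, ascK_append', hpf, ascK_add, ascK_finset_sum, hsw, pfSum]
    congr 1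
    · refine Finset.sum_congr rfl fun j _ => ?_
      rw [← ascK_append', ← ascK_append, A]
      congr 1
      simp
    · rw [← ih (p ++ [b + c]) 0, ← ascK_append', ← ascK_append]
      congr 1
      simp

/-! ### Combinatorics of the produced indices -/

/-- Sum of `F` over all insertions of an entry `1` into `q` (at any of the `|q| + 1` positions),
prefixed by `p`. [folklore] -/
def insSum (F : List ℕ → ℝ≥0∞) : List ℕ → List ℕ → ℝ≥0∞
  | p, [] => F (p ++ [1])
  | p, b :: q => F (p ++ 1 :: b :: q) + insSum F (p ++ [b]) q

/-- Sum of `F` over Hoffman's right-hand side terms located in `q`: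
`∑_{l} ∑_{j ≤ q_l - 2} F(p, q₁, …, q_l - j, j + 1, …)`, prefixed by `p`. [folklore] -/
def splSum (F : List ℕ → ℝ≥0∞) : List ℕ → List ℕ → ℝ≥0∞
  | _, [] => 0
  | p, b :: q => (∑ j ∈ Finset.range (b - 1), F (p ++ (b - j) :: (j + 1) :: q)) +
      splSum F (p ++ [b]) q

/-- With no extra power on the hole, the iteration produces exactly Hoffman's right-hand terms
plus all insertions of `1` (the `j = q_l - 1` terms). [folklore] -/
theorem pfSum_zero_eq : ∀ (F : List ℕ → ℝ≥0∞) (q p : List ℕ), (∀ i ∈ q, 1 ≤ i) →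
    pfSum F p 0 q = splSum F p q + insSum F p q := by
  intro F q
  induction q with
  | nil => intro p _; simp [pfSum, splSum, insSum]
  | cons b q ih =>
    intro p hq
    obtain ⟨b, rfl⟩ : ∃ b', b = b' + 1 := ⟨b - 1, by have := hq b (by simp); omega⟩
    rw [pfSum, splSum, insSum, ih _ fun i hi => hq i (by simp [hi]), Finset.sum_range_succ]
    simp only [add_zero, Nat.add_sub_cancel, Nat.add_sub_cancel_left]
    ring

/-- `insOne` versus `insSum`: the insertions of `1` into `b :: q` not at the front are the
insertions of `1` anywhere into `q`, prefixed by `b`. [folklore] -/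
theorem sum_insOne_cons : ∀ (F : List ℕ → ℝ≥0∞) (q p : List ℕ) (b : ℕ),
    ((insOne (b :: q)).map fun v => F (p ++ v)).sum = insSum F (p ++ [b]) q := by
  intro F q
  induction q with
  | nil => intro p b; simp [insOne, insSum]
  | cons b' q ih =>
    intro p b
    have h := ih (p ++ [b]) b'
    simp only [List.append_assoc, List.singleton_append] at h
    simp only [insOne, List.map_cons, List.map_map, List.sum_cons, Function.comp_def, insSum,
      List.append_assoc, List.cons_append, List.nil_append]
    rw [← h]
    simp only [insOne, List.map_cons, List.map_map, List.sum_cons, Function.comp_def]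

/-! ### Admissibility of the indices in play -/

/-- Raising an entry keeps all entries positive. [folklore] -/
theorem one_le_of_mem_plusOne : ∀ (u : List ℕ), (∀ i ∈ u, 1 ≤ i) →
    ∀ v ∈ plusOne u, ∀ i ∈ v, 1 ≤ i := by
  intro u
  induction u with
  | nil => simp [plusOne]
  | cons b u ih =>
    intro hu v hv
    simp only [plusOne, List.mem_cons, List.mem_map] at hv
    rcases hv with rfl | ⟨v', hv', rfl⟩
    · intro i hi
      rcases List.mem_cons.mp hi with rfl | hi
      · omega
      · exact hu i (List.mem_cons_of_mem b hi)
    · intro i hi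
      rcases List.mem_cons.mp hi with rfl | hi
      · exact hu _ (by simp)
      · exact ih (fun k hk => hu k (List.mem_cons_of_mem b hk)) v' hv' i hi

/-- Raising an entry of an admissible index gives an admissible index. [folklore] -/
theorem isAdmissible_of_mem_plusOne {u v : List ℕ} (hu : MZV.IsAdmissible u)
    (hv : v ∈ plusOne u) : MZV.IsAdmissible v := by
  cases u with
  | nil => simp [plusOne] at hv
  | cons b u =>
    rw [isAdmissible_cons_iff] at hu
    simp only [plusOne, List.mem_cons, List.mem_map] at hv
    rcases hv with rfl | ⟨v', hv', rfl⟩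
    · exact isAdmissible_cons_iff.mpr ⟨by omega, hu.2⟩
    · exact isAdmissible_cons_iff.mpr ⟨hu.1, one_le_of_mem_plusOne u hu.2 v' hv'⟩

/-- On admissible indices, `A` is `ENNReal.ofReal ∘ multipleZeta`: the `plusOne` sum. [folklore] -/
theorem sum_plusOne_A {s : List ℕ} (hs : MZV.IsAdmissible s) :
    ((plusOne s).map A).sum = ((plusOne s).map fun v => ENNReal.ofReal (multipleZeta v)).sum := by
  refine congrArg List.sum (List.map_congr_left fun v hv => ?_)
  exact (ofReal_multipleZeta_eq_A (isAdmissible_of_mem_plusOne hs hv)).symm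

/-- … the insertion sum behind an admissible head. [folklore] -/
theorem insSum_A : ∀ (q p : List ℕ) (a : ℕ), 2 ≤ a → (∀ i ∈ p ++ q, 1 ≤ i) →
    insSum A (a :: p) q = insSum (fun v => ENNReal.ofReal (multipleZeta v)) (a :: p) q := by
  intro q
  induction q with
  | nil =>
    intro p a ha hp
    simp only [insSum, List.cons_append]
    rw [ofReal_multipleZeta_eq_A]
    exact isAdmissible_cons_iff.mpr ⟨ha, fun i hi => by
      rcases List.mem_append.mp hi with hi | hi
      · exact hp i (by simpa using hi)
      · simp at hi; omega⟩
  | cons b q ih =>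
    intro p a ha hp
    simp only [insSum, List.cons_append]
    rw [ofReal_multipleZeta_eq_A, ← List.cons_append, ih (p ++ [b]) a ha (by simpa using hp)]
    exact isAdmissible_cons_iff.mpr ⟨ha, fun i hi => by
      rcases List.mem_append.mp hi with hi | hi
      · exact hp i (List.mem_append.mpr (Or.inl hi))
      · rcases List.mem_cons.mp hi with rfl | hi
        · exact le_rfl
        · exact hp i (List.mem_append.mpr (Or.inr hi))⟩

/-- The insertion sum of `ofReal`s is finite. [folklore] -/
theorem insSum_ofReal_ne_top : ∀ (q p : List ℕ),
    insSum (fun v => ENNReal.ofReal (multipleZeta v)) p q ≠ ∞ := by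
  intro q
  induction q with
  | nil => intro p; simp [insSum]
  | cons b q ih => intro p; simp only [insSum]; exact ENNReal.add_ne_top.mpr ⟨ENNReal.ofReal_ne_top, ih _⟩

/-- … the split sum behind an admissible head. [folklore] -/
theorem splSum_A : ∀ (q p : List ℕ) (a : ℕ), 2 ≤ a → (∀ i ∈ p ++ q, 1 ≤ i) →
    splSum A (a :: p) q = splSum (fun v => ENNReal.ofReal (multipleZeta v)) (a :: p) q := by
  intro q
  induction q with
  | nil => intro p a _ _; simp [splSum]
  | cons b q ih =>
    intro p a ha hp
    simp only [splSum, List.cons_append]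
    rw [ih (p ++ [b]) a ha (by simpa using hp)]
    congr 1
    refine Finset.sum_congr rfl fun j hj => ?_
    rw [ofReal_multipleZeta_eq_A]
    have hj := Finset.mem_range.mp hj
    exact isAdmissible_cons_iff.mpr ⟨ha, fun i hi => by
      rcases List.mem_append.mp hi with hi | hi
      · exact hp i (List.mem_append.mpr (Or.inl hi))
      · rcases List.mem_cons.mp hi with rfl | hi
        · omega
        · rcases List.mem_cons.mp hi with rfl | hi
          · omega
          · exact hp i (List.mem_append.mpr (Or.inr (List.mem_cons_of_mem b hi)))⟩

/-! ### The Fin-indexed sums of the statement -/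

/-- Splitting a sum over the positions of `b :: q` into the head position and the positions of `q`.
[folklore] -/
theorem fin_sum_take_drop_cons {M : Type*} [AddCommMonoid M] (φ : List ℕ → ℕ → List ℕ → M)
    (b : ℕ) (q : List ℕ) :
    ∑ l : Fin (b :: q).length, φ ((b :: q).take l.1) ((b :: q).get l) ((b :: q).drop (l.1 + 1)) =
      φ [] b q + ∑ l : Fin q.length, φ (b :: q.take l.1) (q.get l) (q.drop (l.1 + 1)) := by
  show ∑ l : Fin (q.length + 1),
      φ ((b :: q).take l.1) ((b :: q).get l) ((b :: q).drop (l.1 + 1)) = _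
  rw [Fin.sum_univ_succ]
  simp

/-- The left-hand side of Hoffman's relation, indexed by positions as in `hoffman_relation`, is the
sum over `plusOne`. [folklore] -/
theorem fin_sum_plusOne {M : Type*} [AddCommMonoid M] : ∀ (s : List ℕ) (F : List ℕ → M),
    ∑ l : Fin s.length, F (s.take l.1 ++ [s.get l + 1] ++ s.drop (l.1 + 1)) =
      ((plusOne s).map F).sum := by
  intro s
  induction s with
  | nil => intro F; simp [plusOne]
  | cons b q ih =>
    intro F
    rw [fin_sum_take_drop_cons (fun t x r => F (t ++ [x + 1] ++ r)) b q]
    have h := ih (F ∘ List.cons b)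
    simp only [Function.comp_def, List.cons_append] at h ⊢
    simp only [List.nil_append, List.append_assoc, List.singleton_append] at h ⊢
    rw [h]
    simp [plusOne, List.map_map, Function.comp_def]

/-- The right-hand side of Hoffman's relation, indexed by positions as in `hoffman_relation`, is
`splSum`. [folklore] -/
theorem fin_sum_splSum : ∀ (s p : List ℕ) (F : List ℕ → ℝ≥0∞),
    ∑ l : Fin s.length, ∑ j ∈ Finset.range (s.get l - 1),
        F (p ++ (s.take l.1 ++ [s.get l - j, j + 1] ++ s.drop (l.1 + 1))) = splSum F p s := by
  intro s
  induction s with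
  | nil => intro p F; simp [splSum]
  | cons b q ih =>
    intro p F
    rw [fin_sum_take_drop_cons
      (fun t x r => ∑ j ∈ Finset.range (x - 1), F (p ++ (t ++ [x - j, j + 1] ++ r))) b q, splSum]
    have h := ih (p ++ [b]) F
    simp only [List.append_assoc, List.cons_append, List.nil_append] at h ⊢
    rw [h]

end MZV.HoffmanRel

/-! ### Hoffman's relation -/

open MZV.HoffmanRel in
/-- **Hoffman's relation** (Hoffman 1992, Theorem 5.1) for `multipleZeta`, in the indexing of the
named fact `hoffman_relation`: for admissible `s`,
`∑_l ζ(s₁,…,s_l + 1,…,s_k) = ∑_l ∑_{j=0}^{s_l−2} ζ(s₁,…,s_{l−1}, s_l − j, j + 1, s_{l+1},…,s_k)`.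
Proof: Hoffman's — (1) stuffle with the harmonic factor (`ascK_harm_mul`), (2) telescoping
(`ascK_pw_succ_harm`), iterated partial fractions and swaps (`ascK_hole_eq_pfSum`), and
cancellation of the finite sum of the inserted-`1` values. [cite: Hoffman1992, Theorem 5.1] -/
theorem multipleZeta_hoffman_relation {s : List ℕ} (hs : MZV.IsAdmissible s) :
    (∑ l : Fin s.length, multipleZeta (s.take l.1 ++ [s.get l + 1] ++ s.drop (l.1 + 1))) =
      ∑ l : Fin s.length, ∑ j ∈ Finset.range (s.get l - 1),
        multipleZeta (s.take l.1 ++ [s.get l - j, j + 1] ++ s.drop (l.1 + 1)) := by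
  cases s with
  | nil => simp
  | cons a₀ q =>
    obtain ⟨ha₀, hq⟩ := MZV.isAdmissible_cons_iff.mp hs
    obtain ⟨a, rfl⟩ : ∃ a, a₀ = a + 1 := ⟨a₀ - 1, by omega⟩
    -- the quantity `T = ∑_{chain} m^{-s} H_{m₁}` computed in two ways
    -- (1): stuffle with the harmonic factor
    have hT1 : ascK (((a + 1) :: q).reverse.map pw) (fun t => harm t * 1) 0 =
        ((plusOne ((a + 1) :: q)).map A).sum + ((insOne ((a + 1) :: q)).map A).sum := by
      rw [ascK_harm_mul, harm_zero, zero_mul, zero_add]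
      rfl
    -- (2)+(3): telescoping, then the iteration
    have hT2 : ascK (((a + 1) :: q).reverse.map pw) (fun t => harm t * 1) 0 =
        pfSum A [] 1 (a :: q) := by
      have hrev : ((a + 1) :: q).reverse.map pw = q.reverse.map pw ++ [pw (a + 1)] := by simp
      have htl : (ascK [pw (a + 1)] fun t => harm t * 1) = ascK [pw a, hw 1] fun _ => 1 :=
        funext fun N => ascK_pw_succ_harm a N
      rw [hrev, ascK_append, htl, ← ascK_append, ← ascK_hole_eq_pfSum (a :: q) [] 1]
      congr 1
      simp
    -- comparing
    have hins : ((insOne ((a + 1) :: q)).map A).sum =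
        insSum (fun v => ENNReal.ofReal (multipleZeta v)) [a + 1] q := by
      have h : ((insOne ((a + 1) :: q)).map A).sum = insSum A [a + 1] q := by
        simpa using sum_insOne_cons A q [] (a + 1)
      rw [h, insSum_A q [] (a + 1) ha₀ (by simpa using hq)]
    have hspl : pfSum A [] 1 (a :: q) =
        splSum (fun v => ENNReal.ofReal (multipleZeta v)) [] ((a + 1) :: q) +
          insSum (fun v => ENNReal.ofReal (multipleZeta v)) [a + 1] q := by
      rw [pfSum, splSum]
      simp only [List.nil_append, Nat.add_sub_cancel]
      rw [pfSum_zero_eq A q [a + 1] hq, splSum_A q [] (a + 1) ha₀ (by simpa using hq),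
        insSum_A q [] (a + 1) ha₀ (by simpa using hq), add_assoc]
      congr 1
      refine Finset.sum_congr rfl fun j hj => ?_
      have hj := Finset.mem_range.mp hj
      rw [ofReal_multipleZeta_eq_A (MZV.isAdmissible_cons_iff.mpr ⟨by omega, ?_⟩)]
      intro i hi
      rcases List.mem_cons.mp hi with rfl | hi
      · omega
      · exact hq i hi
    have key : ((plusOne ((a + 1) :: q)).map fun v => ENNReal.ofReal (multipleZeta v)).sum =
        splSum (fun v => ENNReal.ofReal (multipleZeta v)) [] ((a + 1) :: q) := by
      have h := hT1.symm.trans hT2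
      rw [hins, hspl, sum_plusOne_A hs] at h
      exact (ENNReal.add_left_inj (insSum_ofReal_ne_top q [a + 1])).mp h
    -- back to `ℝ`
    have hL : ENNReal.ofReal (∑ l : Fin ((a + 1) :: q).length,
        multipleZeta (((a + 1) :: q).take l.1 ++ [((a + 1) :: q).get l + 1] ++
          ((a + 1) :: q).drop (l.1 + 1))) =
        ((plusOne ((a + 1) :: q)).map fun v => ENNReal.ofReal (multipleZeta v)).sum := by
      rw [ENNReal.ofReal_sum_of_nonneg (fun l _ => multipleZeta_nonneg _)]
      exact fin_sum_plusOne ((a + 1) :: q) fun v => ENNReal.ofReal (multipleZeta v)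
    have hR : ENNReal.ofReal (∑ l : Fin ((a + 1) :: q).length,
        ∑ j ∈ Finset.range (((a + 1) :: q).get l - 1),
          multipleZeta (((a + 1) :: q).take l.1 ++ [((a + 1) :: q).get l - j, j + 1] ++
            ((a + 1) :: q).drop (l.1 + 1))) =
        splSum (fun v => ENNReal.ofReal (multipleZeta v)) [] ((a + 1) :: q) := by
      have h2 := fin_sum_splSum ((a + 1) :: q) [] fun v => ENNReal.ofReal (multipleZeta v)
      simp only [List.nil_append] at h2
      rw [ENNReal.ofReal_sum_of_nonneg (fun l _ => Finset.sum_nonneg fun j _ =>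
        multipleZeta_nonneg _), ← h2]
      exact Finset.sum_congr rfl fun l _ =>
        ENNReal.ofReal_sum_of_nonneg fun j _ => multipleZeta_nonneg _
    have h := hL.trans (key.trans hR.symm)
    exact (ENNReal.ofReal_eq_ofReal_iff (Finset.sum_nonneg fun l _ => multipleZeta_nonneg _)
      (Finset.sum_nonneg fun l _ => Finset.sum_nonneg fun j _ => multipleZeta_nonneg _)).mp h

end Literature.NumberTheory.Transcendental
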